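import Mathlib

/-!
# AN49 — algebraic core of the ♯/♭ edge-pair transport (FE37 §10 (R9a)(R9b)), kernel-checked

Work file of planner seat `bsd-f1-sign2-an` g33 for crux `RankOneAtTwoBigImageOddLocal`
(stmt-BirchSwinnertonDyer-23715).  Companion to `SharpFlatEdgeAN48.lean` (v4) and the memo
`FE37-edge-matrix-FE.md` §10.

Setting of FE37: level matrices `C_m = [[a,1],[-F_m,0]]`, `ℋ_n = C_2 ⋯ C_n`, `K_n = ι ℋ_n`
(the involution `ι : X ↦ X⁻¹` applied entrywise, so `K_n = ιC_2 ⋯ ιC_n` with `ιC_m = [[a,1],[-ιF_m,0]]`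
and `F_m = X^{2^{m-2}} · ιF_m`), and the transport `M_n = ℋ_n (ιℋ_n)⁻¹ = ℋ_n · adj K_n / det K_n`.
Here everything is stated over an arbitrary commutative ring `R`, with the ι-facts as hypotheses:
`F = x * g` plays `F_{n+1} = X^{2^{n-1}} · ιF_{n+1}` and `x - 1 = t * det K` plays
`X^{2^{n-1}} - 1 = (X-1) · X^{2^{n-1}-1} · ιD_n`.

* `levelMat_mul_adjugate` — (R9a): `C(a, x g) · adj C(a, g) = g • diag(1, x)`.
* `step_mul_adjugate_sub` — `ℋ' · adj K' = g • (ℋ · adj K) + (g (x-1)) • (ℋ E₂₂ adj K)`.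
* `transport_step` — (R9b) TELESCOPING: if `det K • M = ℋ · adj K` and `x - 1 = t · det K` then
  `det K' • (M + t • (ℋ E₂₂ adj K)) = ℋ' · adj K'` for `ℋ' = ℋ C(a, x g)`, `K' = K C(a, g)`;
  i.e. the level-(n+1) transport is the level-n transport plus an INTEGRAL rank-one correction,
  so `M_n ∈ M₂(ℤ[X^±])` for all `n` by induction (FE37 (R9b); previously verified only for n ≤ 12).
* `transport_unique` — over a ring where `det K` is not a zero divisor the transport is unique,
  so the recursion determines `M_{n+1}`.

No `sorry`; standard axioms.  PARTITION 52421 = 17880+27650+3440+3451 unchanged; BSD is NOT proved.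
-/

namespace Summit.BirchSwinnertonDyer.BirchSwinnertonDyer.Cruxes.RankOneAtTwoBigImageOddLocal.EdgeTransportAN49

open Matrix

variable {R : Type*} [CommRing R]

/-- The level matrix `C(a, F) = [[a, 1], [-F, 0]]` of the ♯/♭ (tandem) recursion. -/
def levelMat (a F : R) : Matrix (Fin 2) (Fin 2) R := !![a, 1; -F, 0]

/-- The rank-one idempotent `E₂₂ = diag(0, 1)`. -/
def E22 : Matrix (Fin 2) (Fin 2) R := !![0, 0; 0, 1]

theorem det_levelMat (a F : R) : (levelMat a F).det = F := by
  simp [levelMat, Matrix.det_fin_two]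

theorem adjugate_levelMat (a F : R) : (levelMat a F).adjugate = !![0, -1; F, a] := by
  simp [levelMat, Matrix.adjugate_fin_two]

/-- (R9a) one-factor identity: if `F = x * g` then `C(a,F) · adj C(a,g) = g • diag(1,x)`. -/
theorem levelMat_mul_adjugate (a x g : R) :
    levelMat a (x * g) * (levelMat a g).adjugate = g • !![1, 0; 0, x] := by
  rw [adjugate_levelMat]
  ext i j
  fin_cases i <;> fin_cases j <;> (simp [levelMat, Matrix.mul_apply, Fin.sum_univ_two]; try ring)

/-- One step of the product: `(ℋ C(a,xg)) · adj (K C(a,g)) = g • (ℋ · diag(1,x) · adj K)`. -/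
theorem step_mul_adjugate (H K : Matrix (Fin 2) (Fin 2) R) (a x g : R) :
    (H * levelMat a (x * g)) * (K * levelMat a g).adjugate
      = g • (H * !![1, 0; 0, x] * K.adjugate) := by
  rw [Matrix.adjugate_mul_distrib, Matrix.mul_assoc, ← Matrix.mul_assoc (levelMat a (x * g)),
    levelMat_mul_adjugate, Matrix.smul_mul, Matrix.mul_smul, Matrix.mul_assoc]

theorem diag_one_x_eq (x : R) : (!![1, 0; 0, x] : Matrix (Fin 2) (Fin 2) R) = 1 + (x - 1) • E22 := by
  ext i j
  fin_cases i <;> fin_cases j <;> simp [E22]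

/-- Telescoping form of one step:
`ℋ' · adj K' = g • (ℋ · adj K) + (g * (x - 1)) • (ℋ · E₂₂ · adj K)`. -/
theorem step_mul_adjugate_sub (H K : Matrix (Fin 2) (Fin 2) R) (a x g : R) :
    (H * levelMat a (x * g)) * (K * levelMat a g).adjugate
      = g • (H * K.adjugate) + (g * (x - 1)) • (H * E22 * K.adjugate) := by
  rw [step_mul_adjugate, diag_one_x_eq, Matrix.mul_add, Matrix.add_mul, Matrix.mul_one, smul_add,
    Matrix.mul_smul, Matrix.smul_mul, smul_smul]

/-- Determinant of the next level: `det (K C(a,g)) = det K * g`. -/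
theorem det_step (K : Matrix (Fin 2) (Fin 2) R) (a g : R) :
    (K * levelMat a g).det = K.det * g := by
  rw [Matrix.det_mul, det_levelMat]

/-- (R9b) TELESCOPING.  If `M` is a transport at level `n` (`det K • M = ℋ adj K`) and the
ι-defect `x - 1` of the new factor is divisible by `det K` (`x - 1 = t * det K`), then
`M + t • (ℋ E₂₂ adj K)` is a transport at level `n+1`.  In FE37: `x = X^{2^{n-1}}`,
`det K = ιD_n`, `t = (X - 1) X^{2^{n-1}-1}`, and the correction is the integral rank-one matrix
`T · X^{2^{n-1}-1} (ℋ_n e₂)(e₂ᵀ adj ιℋ_n)`. -/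
theorem transport_step (H K M : Matrix (Fin 2) (Fin 2) R) (a x g t : R)
    (hM : K.det • M = H * K.adjugate) (hx : x - 1 = t * K.det) :
    (K * levelMat a g).det • (M + t • (H * E22 * K.adjugate))
      = (H * levelMat a (x * g)) * (K * levelMat a g).adjugate := by
  rw [step_mul_adjugate_sub, det_step, smul_add, ← hM, hx, smul_smul, smul_smul, mul_comm K.det g,
    show g * K.det * t = g * (t * K.det) by ring]

/-- Uniqueness of the transport when `det K` is not a zero divisor (e.g. over the domain `ℤ[X^±]`):
so `transport_step` DETERMINES `M_{n+1}` from `M_n`, and integrality propagates. -/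
theorem transport_unique (H K M M' : Matrix (Fin 2) (Fin 2) R) (hK : IsLeftRegular K.det)
    (hM : K.det • M = H * K.adjugate) (hM' : K.det • M' = H * K.adjugate) : M = M' := by
  have h : K.det • M = K.det • M' := by rw [hM, hM']
  ext i j
  have hij := congrArg (fun A : Matrix (Fin 2) (Fin 2) R => A i j) h
  simp only [Matrix.smul_apply, smul_eq_mul] at hij
  exact hK hij

/-- The induction packaged: starting from a transport `M₀` at some level and a list of steps
`(aᵢ, xᵢ, gᵢ, tᵢ)` each satisfying the divisibility hypothesis at its level, the recursively
corrected matrix is a transport at the final level.  (Statement for ONE further step composed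
twice, which is the shape used in FE37; the general list version is a routine `List.foldl`.) -/
theorem transport_two_steps (H K M : Matrix (Fin 2) (Fin 2) R) (a₁ x₁ g₁ t₁ a₂ x₂ g₂ t₂ : R)
    (hM : K.det • M = H * K.adjugate) (hx₁ : x₁ - 1 = t₁ * K.det)
    (hx₂ : x₂ - 1 = t₂ * (K * levelMat a₁ g₁).det) :
    let H₁ := H * levelMat a₁ (x₁ * g₁)
    let K₁ := K * levelMat a₁ g₁
    let M₁ := M + t₁ • (H * E22 * K.adjugate)
    (K₁ * levelMat a₂ g₂).det • (M₁ + t₂ • (H₁ * E22 * K₁.adjugate))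
      = (H₁ * levelMat a₂ (x₂ * g₂)) * (K₁ * levelMat a₂ g₂).adjugate := by
  intro H₁ K₁ M₁
  exact transport_step H₁ K₁ M₁ a₂ x₂ g₂ t₂ (transport_step H K M a₁ x₁ g₁ t₁ hM hx₁) hx₂

end Summit.BirchSwinnertonDyer.BirchSwinnertonDyer.Cruxes.RankOneAtTwoBigImageOddLocal.EdgeTransportAN49
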